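import Literature.MathematicalPhysics.QuantumFieldTheory.Balaban1983to89.B9Thm39Sum

/-!
# `Balaban1983to89.B9Thm39CinvFirstSum` — [Balaban1985BackgroundPropagators] (3.95) p. 411, FIRST SUM: the (2.83)-estimate of [4] AT A GENERAL BLOCK
# MAP (the `𝔸`-valued block carrier of def-Y's `C(U)` in real coordinates) — r06's `B9Thm39Sum.firstSum_term_majorant` / `firstSum_majorant` re-run
# with `blk : X → 𝔅` in place of the identity (cell `lit-balaban`, G-B9-LETTERS module M5.6 FILE 2, seat p21 gen 31)

statement-level skeleton of published theorems with citation tags; proofs where landed; nothing here is a claim about the Yang–Mills mass gap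

CITATION HEADER (lean-in-tree rule).  B9 = T. Bałaban, *Propagators for lattice gauge theories in a background field*, Commun. Math. Phys. **99** (1985)
389–434, p. 411: (3.95) «Q′G′²Q′*C₀ = I + Σ_□(1 − □̃)Q′G′²Q′*h_□C_□h_□ + … = I − R», «By the same estimates as in [4], especially (2.83)–(2.85), we can see that
the operator R is small», «The characteristic function 1 − □̃ at the beginning of the term, and the function h_□ at the end, restrict a kernel of the term to
points separated at least by a distance MLʲη (if □ ∈ 𝒟_j). Hence the part of the exponential factor can be estimated by e^{−¼δ₀M}».  [4] = T. Bałaban,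
*Propagators and renormalization transformations for lattice gauge theories. II*, Commun. Math. Phys. **96** (1984) 223–250 [Balaban1984PropagatorsII],
p. 237–238 (2.83) «= O(1)e^{−¼δ₀M}L^{4(j−j′)}e^{−¼δ₀RM max{|j−j′|−1,0}}e^{−δ₁d(y,y′)}(L^{j′}η)^{−d} ≦ O(1)e^{−⅛δ₀M}e^{−δ₁d(y,y′)}(L^{j′}η)^{−d}», (2.85)
«|R(y, y′)| ≦ O(M⁻¹)e^{−δ₁d(y,y′)}(L^{j′}η)^{−d}», (2.52) p. 232 (composition of majorants), (2.60)–(2.61) p. 234.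
Rows B9.Eq3.95 × B4.Eq2.83 × B4.Eq2.85 (cells only; no row head changes).

WHY THIS FILE.  r06's `B9Thm39Sum` §2b kernel-checks [4] (2.83) ⇒ (2.85) for the first sum of (3.95) for operators on SCALAR functions on 𝔅 (block map =
identity).  M5.6 reads `C(U)` on `𝔸`-valued block functions in real coordinates, carrier `BlkY i × ι`, block map `(s, j) ↦ ιB s` (FILE 1
`B9Thm39CinvTorusRegular`); its displayed first-sum majorant `hR₁` therefore needs the SAME estimate at a general block map.  The proofs are r06's, line by
line; only `blk` replaces the identity (r06's generic lemmas `hasMajorant_mul`, `hasMajorant_mulOp_cut`, `hasMajorant_localSum_right` were already stated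
for a general block map).

WHAT IS PROVED (all `theorem`s, 0 `def`, 0 sorry, 0 new named facts).
* ★★ `firstSum_term_majorant_blk` — [4] (2.83) for the □-term `(1 − □̃)L·h_□C_□h_□` at a general block map: hypotheses of the printed shape `hL` (upper
  majorant `κP(a)⁻¹e^{−a_Lδ₀d}` of L = Q′G′²Q′*), `hT` (the two-sided-localized (3.48)-majorant of `h_□C_□h_□`), the cut-off `χ` (`|χ| ≤ 1`, `= 0` over
  `S_χ`), separation `d(a, a″) ≥ D_sep` for `a ∉ S_χ`, `a″ ∈ S_□`, scale transfer at exponent `α_st` (`B9Ineq347.ScaleTransfer`), (2.61) at `b − ρ`,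
  `α_st + a_sep + ρ ≤ a_L` ⟹ majorant `1_{a∉S_χ}1_{S_□}(a′)·κB₀C·c₁(δ₀, b−ρ)·e^{−a_sepδ₀D_sep}·e^{−ρδ₀d(a,a′)}`.
* ★ `firstSum_majorant_blk` — summed over □ with source-side overlap ≤ N: majorant `N·Θ·e^{−ρδ₀d}` ((2.85)-shape; Θ's small factor `e^{−a_sepδ₀D_sep}` is
  r06's `firstSum_small_factor` by name).

HONEST SCOPE.  Bookkeeping over [4]'s block-majorant calculus (pv08 `B6RandomWalk`); the inputs `hL`, `hT`, separation and scale transfer are hypotheses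
of the printed shape (discharged at def-Y's letters by FILES 3/6 of the module); nothing of [B9]/[4] asserted beyond what is proved; NOT summit progress.
RELATED, NOT DUPLICATED: r06 `B9Thm39Sum.firstSum_term_majorant`/`firstSum_majorant` (identity block map) — the special case `blk = id`; searched
2026-08-28 `lean search 'firstSum_term_majorant' --decl` = r06's two only.
-/

namespace Literature.MathematicalPhysics.QuantumFieldTheory.Balaban1983to89.B9Thm39CinvFirstSum

open Literature.MathematicalPhysics.QuantumFieldTheory.Balaban1983to89
open Finset

variable {g : B9.Geometry} [Fintype g.Site] [DecidableEq g.Site] {R : ℝ} {H : Prop} {X : Type}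

/-- ★★ **[4] (2.83) FOR THE □-TERM `(1 − □̃)L·h_□C_□h_□` OF THE FIRST SUM OF (3.95), AT A GENERAL BLOCK MAP** — r06's `firstSum_term_majorant` with
`blk : X → 𝔅` for the identity; same hypotheses, same constants, same proof. [cite: Balaban1985BackgroundPropagators, (3.95) p.411; Balaban1984PropagatorsII, (2.83) p.238] -/
theorem firstSum_term_majorant_blk (blk : X → g.Site) (d : ℕ) (δ₀ aL αst asep ρ b κ B₀ C Dsep : ℝ) (P : g.Site → ℝ)
    (Sχ S : Finset g.Site) (χc : X → ℝ)
    (hκ : 0 ≤ κ) (hB₀ : 0 ≤ B₀) (hC : 0 ≤ C) (hP : ∀ y, 0 < P y) (hδ₀ : 0 ≤ δ₀)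
    (hasep : 0 ≤ asep) (hρ : 0 ≤ ρ) (hsplit : αst + asep + ρ ≤ aL)
    (htri : B6RandomWalk.Triangle254 (B9Thm34Ext.toB6 g R H)) (hsymm : ∀ a b : g.Site, g.dist a b = g.dist b a)
    (hdnn : ∀ a b : g.Site, 0 ≤ g.dist a b)
    (hST : B9Ineq347.ScaleTransfer g δ₀ αst C P)
    (h261 : B6RandomWalk.Ineq261 d (B9Thm34Ext.toB6 g R H) δ₀ (b - ρ))
    (hχ1 : ∀ x, |χc x| ≤ 1) (hχ0 : ∀ x, blk x ∈ Sχ → χc x = 0)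
    (hsep : ∀ y, y ∉ Sχ → ∀ y'' ∈ S, Dsep ≤ g.dist y y'')
    {Lop T : Module.End ℝ (X → ℝ)}
    (hL : B6RandomWalk.HasMajorant (g := B9Thm34Ext.toB6 g R H) blk Lop
      (fun (a y'' : g.Site) => κ * (P a)⁻¹ * Real.exp (-(aL * δ₀ * g.dist a y''))))
    (hT : B6RandomWalk.HasMajorant (g := B9Thm34Ext.toB6 g R H) blk T
      (fun (y'' b' : g.Site) => (if y'' ∈ S then (1 : ℝ) else 0) * (if b' ∈ S then (1 : ℝ) else 0) *
        (B₀ * P y'' * Real.exp (-(b * δ₀ * g.dist y'' b'))))) :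
    B6RandomWalk.HasMajorant (g := B9Thm34Ext.toB6 g R H) blk (B9Thm37Sum.mulOp χc * Lop * T)
      (fun (a b' : g.Site) => (if a ∈ Sχ then (0 : ℝ) else 1) * (if b' ∈ S then (1 : ℝ) else 0) *
        (κ * B₀ * C * B6.c1 d δ₀ (b - ρ) * Real.exp (-(asep * δ₀ * Dsep))) * Real.exp (-(ρ * δ₀ * g.dist a b'))) := by
  have hK₂ : ∀ y'' b' : g.Site, 0 ≤ (if y'' ∈ S then (1 : ℝ) else 0) * (if b' ∈ S then (1 : ℝ) else 0) *
      (B₀ * P y'' * Real.exp (-(b * δ₀ * g.dist y'' b'))) := fun y'' b' =>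
    mul_nonneg (mul_nonneg (by split_ifs <;> norm_num) (by split_ifs <;> norm_num))
      (mul_nonneg (mul_nonneg hB₀ (hP y'').le) (Real.exp_nonneg _))
  have hLT := B6RandomWalk.hasMajorant_mul (g := B9Thm34Ext.toB6 g R H) blk hL hT hK₂
  have hcut := B9Thm39Sum.hasMajorant_mulOp_cut (R := R) (H := H) blk hLT χc hχ1 Sχ hχ0
  rw [mul_assoc]
  refine B6RandomWalk.hasMajorant_mono (g := B9Thm34Ext.toB6 g R H) _ hcut fun (a b' : g.Site) => ?_
  by_cases ha : a ∈ Sχ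
  · simp [ha]
  simp only [ha, if_false, one_mul]
  have hcoefρ : 0 ≤ ρ * δ₀ := mul_nonneg hρ hδ₀
  have hind : 0 ≤ (if b' ∈ S then (1 : ℝ) else 0) := by split_ifs <;> norm_num
  have hterm : ∀ y'' : g.Site,
      κ * (P a)⁻¹ * Real.exp (-(aL * δ₀ * g.dist a y'')) *
          ((if y'' ∈ S then (1 : ℝ) else 0) * (if b' ∈ S then (1 : ℝ) else 0) *
            (B₀ * P y'' * Real.exp (-(b * δ₀ * g.dist y'' b')))) ≤
        (if b' ∈ S then (1 : ℝ) else 0) * (κ * B₀ * C * Real.exp (-(asep * δ₀ * Dsep))) *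
          Real.exp (-(ρ * δ₀ * g.dist a b')) * Real.exp (-((b - ρ) * δ₀ * g.dist b' y'')) := by
    intro y''
    by_cases hy'' : y'' ∈ S
    · simp only [hy'', if_true, one_mul]
      have hsplitexp : Real.exp (-(aL * δ₀ * g.dist a y'')) ≤
          Real.exp (-(αst * δ₀ * g.dist a y'')) * Real.exp (-(asep * δ₀ * g.dist a y'')) *
            Real.exp (-(ρ * δ₀ * g.dist a y'')) := by
        rw [← Real.exp_add, ← Real.exp_add]
        refine Real.exp_le_exp.mpr ?_
        have h1 := mul_le_mul_of_nonneg_right hsplit (mul_nonneg hδ₀ (hdnn a y''))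
        nlinarith [h1]
      have hst : (P a)⁻¹ * (Real.exp (-(αst * δ₀ * g.dist a y'')) * P y'') ≤ C := by
        have h1 := hST a y''
        calc (P a)⁻¹ * (Real.exp (-(αst * δ₀ * g.dist a y'')) * P y'') ≤ (P a)⁻¹ * (C * P a) :=
              mul_le_mul_of_nonneg_left h1 (inv_nonneg.mpr (hP a).le)
          _ = C := by rw [mul_comm C, ← mul_assoc, inv_mul_cancel₀ (hP a).ne', one_mul]
      have hsepexp : Real.exp (-(asep * δ₀ * g.dist a y'')) ≤ Real.exp (-(asep * δ₀ * Dsep)) := by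
        refine Real.exp_le_exp.mpr ?_
        have h1 := mul_le_mul_of_nonneg_left (hsep a ha y'' hy'') (mul_nonneg hasep hδ₀)
        linarith
      have htri' : Real.exp (-(ρ * δ₀ * g.dist a y'')) * Real.exp (-(b * δ₀ * g.dist y'' b')) ≤
          Real.exp (-(ρ * δ₀ * g.dist a b')) * Real.exp (-((b - ρ) * δ₀ * g.dist b' y'')) := by
        rw [← Real.exp_add, ← Real.exp_add]
        refine Real.exp_le_exp.mpr ?_
        have h0 : g.dist a b' ≤ g.dist a y'' + g.dist y'' b' := htri a y'' b'
        have h1 := mul_le_mul_of_nonneg_left h0 hcoefρ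
        rw [hsymm b' y'']
        nlinarith [h1]
      have hrest : 0 ≤ κ * (P a)⁻¹ * ((if b' ∈ S then (1 : ℝ) else 0) *
          (B₀ * P y'' * Real.exp (-(b * δ₀ * g.dist y'' b')))) :=
        mul_nonneg (mul_nonneg hκ (inv_nonneg.mpr (hP a).le))
          (mul_nonneg hind (mul_nonneg (mul_nonneg hB₀ (hP y'').le) (Real.exp_nonneg _)))
      have hkab : 0 ≤ (if b' ∈ S then (1 : ℝ) else 0) * κ * B₀ := mul_nonneg (mul_nonneg hind hκ) hB₀
      calc κ * (P a)⁻¹ * Real.exp (-(aL * δ₀ * g.dist a y'')) *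
            ((if b' ∈ S then (1 : ℝ) else 0) * (B₀ * P y'' * Real.exp (-(b * δ₀ * g.dist y'' b'))))
          = Real.exp (-(aL * δ₀ * g.dist a y'')) * (κ * (P a)⁻¹ *
              ((if b' ∈ S then (1 : ℝ) else 0) * (B₀ * P y'' * Real.exp (-(b * δ₀ * g.dist y'' b'))))) := by ring
        _ ≤ Real.exp (-(αst * δ₀ * g.dist a y'')) * Real.exp (-(asep * δ₀ * g.dist a y'')) *
              Real.exp (-(ρ * δ₀ * g.dist a y'')) * (κ * (P a)⁻¹ *
              ((if b' ∈ S then (1 : ℝ) else 0) * (B₀ * P y'' * Real.exp (-(b * δ₀ * g.dist y'' b'))))) :=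
            mul_le_mul_of_nonneg_right hsplitexp hrest
        _ = (if b' ∈ S then (1 : ℝ) else 0) * κ * B₀ * ((P a)⁻¹ * (Real.exp (-(αst * δ₀ * g.dist a y'')) * P y'')) *
              Real.exp (-(asep * δ₀ * g.dist a y'')) *
              (Real.exp (-(ρ * δ₀ * g.dist a y'')) * Real.exp (-(b * δ₀ * g.dist y'' b'))) := by ring
        _ ≤ (if b' ∈ S then (1 : ℝ) else 0) * κ * B₀ * C * Real.exp (-(asep * δ₀ * Dsep)) *
              (Real.exp (-(ρ * δ₀ * g.dist a b')) * Real.exp (-((b - ρ) * δ₀ * g.dist b' y''))) := by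
            refine mul_le_mul ?_ htri' (mul_nonneg (Real.exp_nonneg _) (Real.exp_nonneg _)) ?_
            · exact mul_le_mul (mul_le_mul_of_nonneg_left hst hkab) hsepexp (Real.exp_nonneg _)
                (mul_nonneg hkab hC)
            · exact mul_nonneg (mul_nonneg hkab hC) (Real.exp_nonneg _)
        _ = _ := by ring
    · simp only [hy'', if_false, zero_mul, mul_zero]
      exact mul_nonneg (mul_nonneg (mul_nonneg hind
        (mul_nonneg (mul_nonneg (mul_nonneg hκ hB₀) hC) (Real.exp_nonneg _))) (Real.exp_nonneg _)) (Real.exp_nonneg _)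
  have hpref : 0 ≤ (if b' ∈ S then (1 : ℝ) else 0) * (κ * B₀ * C * Real.exp (-(asep * δ₀ * Dsep))) *
      Real.exp (-(ρ * δ₀ * g.dist a b')) :=
    mul_nonneg (mul_nonneg hind (mul_nonneg (mul_nonneg (mul_nonneg hκ hB₀) hC) (Real.exp_nonneg _)))
      (Real.exp_nonneg _)
  calc ∑ y'' : g.Site, κ * (P a)⁻¹ * Real.exp (-(aL * δ₀ * g.dist a y'')) *
          ((if y'' ∈ S then (1 : ℝ) else 0) * (if b' ∈ S then (1 : ℝ) else 0) *
            (B₀ * P y'' * Real.exp (-(b * δ₀ * g.dist y'' b'))))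
      ≤ ∑ y'' : g.Site, (if b' ∈ S then (1 : ℝ) else 0) * (κ * B₀ * C * Real.exp (-(asep * δ₀ * Dsep))) *
          Real.exp (-(ρ * δ₀ * g.dist a b')) * Real.exp (-((b - ρ) * δ₀ * g.dist b' y'')) :=
        Finset.sum_le_sum fun y'' _ => hterm y''
    _ = (if b' ∈ S then (1 : ℝ) else 0) * (κ * B₀ * C * Real.exp (-(asep * δ₀ * Dsep))) *
          Real.exp (-(ρ * δ₀ * g.dist a b')) * ∑ y'' : g.Site, Real.exp (-((b - ρ) * δ₀ * g.dist b' y'')) := by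
        rw [Finset.mul_sum]
    _ ≤ (if b' ∈ S then (1 : ℝ) else 0) * (κ * B₀ * C * Real.exp (-(asep * δ₀ * Dsep))) *
          Real.exp (-(ρ * δ₀ * g.dist a b')) * B6.c1 d δ₀ (b - ρ) := mul_le_mul_of_nonneg_left (h261 b') hpref
    _ = _ := by ring

/-- ★ **(2.83) ⇒ (2.85) FOR THE FIRST SUM OF (3.95), SUMMED OVER □, AT A GENERAL BLOCK MAP** — r06's `firstSum_majorant` with `blk`: uniform □-term
majorants `1_{a∉S_χ(□)}1_{S_□}(a′)Θe^{−ρδ₀d}` and source-side overlap ≤ N give `N·Θ·e^{−ρδ₀d(a,a′)}`.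
[cite: Balaban1985BackgroundPropagators, (3.95) p.411; Balaban1984PropagatorsII, (2.83)–(2.85) p.238] -/
theorem firstSum_majorant_blk (blk : X → g.Site) (ρ δ₀ Θ N : ℝ) {ι : Type} [Fintype ι] (Sχ S : ι → Finset g.Site)
    (Tm : ι → Module.End ℝ (X → ℝ)) (hΘ : 0 ≤ Θ)
    (hTm : ∀ i, B6RandomWalk.HasMajorant (g := B9Thm34Ext.toB6 g R H) blk (Tm i)
      (fun (a b' : g.Site) => (if a ∈ Sχ i then (0 : ℝ) else 1) * (if b' ∈ S i then (1 : ℝ) else 0) * Θ *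
        Real.exp (-(ρ * δ₀ * g.dist a b'))))
    (hcnt : ∀ b' : g.Site, (∑ i, if b' ∈ S i then (1 : ℝ) else 0) ≤ N) :
    B6RandomWalk.HasMajorant (g := B9Thm34Ext.toB6 g R H) blk (∑ i, Tm i)
      (fun (a b' : g.Site) => N * (Θ * Real.exp (-(ρ * δ₀ * g.dist a b')))) := by
  refine B9Thm39Sum.hasMajorant_localSum_right (G := B9Thm34Ext.toB6 g R H) blk Tm
    (fun i (b' : g.Site) => if b' ∈ S i then (1 : ℝ) else 0)
    (fun (a b' : g.Site) => Θ * Real.exp (-(ρ * δ₀ * g.dist a b'))) N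
    (fun a b' => mul_nonneg hΘ (Real.exp_nonneg _)) (fun i => ?_) hcnt
  refine B6RandomWalk.hasMajorant_mono (g := B9Thm34Ext.toB6 g R H) _ (hTm i) fun (a b' : g.Site) => ?_
  have hE : 0 ≤ Θ * Real.exp (-(ρ * δ₀ * g.dist a b')) := mul_nonneg hΘ (Real.exp_nonneg _)
  by_cases ha : a ∈ Sχ i
  · simp only [ha, if_true, zero_mul]
    exact mul_nonneg (by split_ifs <;> norm_num) hE
  · simp only [ha, if_false, one_mul]
    exact le_of_eq (by ring)

end Literature.MathematicalPhysics.QuantumFieldTheory.Balaban1983to89.B9Thm39CinvFirstSum
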